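import Mathlib
import Literature.NumberTheory.LFunctions.WeilTwoPrimeOddMarginGCert
import Literature.NumberTheory.LFunctions.WeilTwoPrimeQuadratic
import Summits.RiemannHypothesis.RiemannHypothesis.Theses.WeilGroundState
import HarnessLib

/-!
# The `{2,3}`-window ladder: the certified odd-sector bound at window `16/25` (L-side of cell `G₁ = [63/100, 16/25]`)

Support file (`--supports stmt-RiemannHypothesis-18085`; cruxes `NoParityCrossing` 18085 / `GroundStateSimpleEven` 1526 /
`EvenWinsBeyondArch` 15432 = GroundBarta rung 4, 18807): every `L²`-normalised ODD Weil test function supported in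
`[-16/25, 16/25]` has `Re Q(g) ≥ 1/1000000000` — the L-side of the cell `[63/100, 16/25]` of the cell transfer, whose U-side is
`trialUpperG : ε(63/100) ≤ 21/100000000000` (landed).  It is the kernel-checked two-prime odd-sector MARGIN certificate
`weilCert23G` (`Literature/NumberTheory/LFunctions/WeilTwoPrimeOddMarginG*.lean`: Yoshida's moment method [Yoshida 1992, Thm 1] in the
two-prime analytic form `E₂₃` with the 248 certified cells of the weight on `[0, 80]`, `N = 157`, certificate F's Legendre blocks
re-used, odd block at the lowered Bessel coefficient `κ'`, margin `κ − κ' ≥ 10⁻⁹`; soundness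
`WeilCert23.weilTwoPrimeQuadratic_margin_of_parts`), transported to `Re Q` by `weilQuadratic_re_eq_weilTwoPrimeQuadratic`
(`16/25 ≤ log 2`).  Template: `…SimpleEvenOddLowerF.lean`.
-/

noncomputable section

open Set MeasureTheory

namespace Summit.RiemannHypothesis.RiemannHypothesis.Theorems

open Literature.NumberTheory.LFunctions

/-- **Certified odd-sector lower bound at window `16/25`**: every `L²`-normalised odd Weil test function on
`[-16/25, 16/25]` has `Re Q ≥ 1/1000000000` (two-prime odd-sector margin certificate G). [folklore] -/
theorem oddLowerG64 : ∀ g : ℝ → ℂ, IsWeilTest g → tsupport g ⊆ Icc (-(16 / 25 : ℝ)) (16 / 25) →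
    ∫ x, ‖g x‖ ^ 2 = (1 : ℝ) → (∀ x, g (-x) = -g x) → (1 / 1000000000 : ℝ) ≤ (weilQuadratic g).re := by
  intro g hg hs hn ho
  have hl2 := Real.log_two_gt_d9
  have hs2 : tsupport g ⊆ Icc (-Real.log 2) (Real.log 2) :=
    hs.trans (Icc_subset_Icc (by norm_num at hl2 ⊢; linarith) (by norm_num at hl2 ⊢; linarith))
  have h := oddMargin_weilCert23G hg hs ho
  rw [weilQuadratic_re_eq_weilTwoPrimeQuadratic hg hs2]
  have hn' : weilNorm2Sq g = 1 := hn
  rw [hn', mul_one] at h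
  exact h

end Summit.RiemannHypothesis.RiemannHypothesis.Theorems
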